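import Summits.QuantumFields.YangMills.Theorems.BalabanUVNodesK1V6Defs
import Summits.QuantumFields.YangMills.Theorems.BalabanUVNodesK1WindowKOfRunRowsSurvivors

/-!
# Rev 27 of `route-QuantumFields-BalabanUVNodes` (director-ym №29 PRESS Variant Rʳ, plan g84 `D84-REV26R`) — THE RUN-ROWS CURRENCY BY NAME:
# K1⁸ `StabilityBRunRowsAtRecordR13SepCoPH` (stmt-QuantumFields-26907)'s rows conjunct `RunRowsCont13 F θ`, the (C) letter `Cont13All`, the ∀θ SUPPLIER programme `RowsContAll`,
# `Iff.rfl` mirrors of the two NEW ITEM TEXTS (K1⁸ 26907, K2⁸ `EndpointGivenRunRowsR13SepCoPH` 26908), and the by-name bridges K1⁸ → K1⁷, programme ⟹ K2⁷, K1⁷ + programme ⟹ K1⁸,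
# K1 v6's two registered stub texts + `Cont13All` ⟹ K1⁸ (№29 (i)+(v) certificate)

Cell `ym-nodeO-ideate`, DEFINER seat `ym-nodeO-def-1` (gen 7).  `--kind definition --supports stmt-QuantumFields-26907 --as helper --no-relocate`; count-neutral.
Precedent and pattern: `Thm/BalabanUVNodesK0V19Defs` (K0⁷ V19), `…K1V6Defs` (K1⁷ v6), `…K2V6Defs` ∕ `…K2V7Defs` (K2⁷ v6 ∕ v7-corner): the texts of record as TREE NAMES with `Iff.rfl`
mirrors, so that suppliers and stub proofs can be filed BY NAME with one `import`.  This file is the tree edition, BY NAME and retargeted to the ROUTE DECLS, of §0–§2 of plan g84's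
kernel sheet `HOME/pub-ymgap-plan/D84-REV26R/Sketch26R.lean` (sha16 6e11740513bc9591; farm rc 0 · 0 sorry), whose `K1R8` ∕ `K2R8` became the route decls at rev 26
(`[YMPLAN-G84-REV26R-LANDED]`, pub-ymgap bus l.31700, 2026-08-28T08:10Z: rev 26 29dee747fc28 → rev 27 12afebc05bbc; K1⁸ = stmt-QuantumFields-26907 crux r3 DECIDING, K2⁸ =
stmt-QuantumFields-26908 support r9 born closed, K1⁷ 20542 ∕ K2⁷ 20543 → `aside` with their decls, skeletons and by-name concluders kept as history ∕ supplier roads).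
[I] = [Balaban1987RG1] Commun. Math. Phys. **109** (1987); [II] = [Balaban1988RG2Cluster] Commun. Math. Phys. **116** (1988); [V] = [Balaban1989LargeFieldII] Commun. Math. Phys. **122** (1989).

WHY.  After rev 27 the K2 desks' supplier roads (corner pair, named jets, U3 letters, (C) desks, an4's weak currency) no longer aim at END (`…Theses.BalabanUVNodes.EndpointGivenBR13SepCoPH`,
now `aside`) but at K1⁸'s LAST CONJUNCT AT THE WITNESS — the run rows (i) run-wise constant remainder, (iv) run-wise partial-sum floor, (C) run-wise survivor continuity of
`β_θ := Node00.betaOfRecord₁₃ F 2 θ.toStage13Params` on SOME level `γ₀ > 0` — which the route file can only spell INLINE (its carriers `RunConstRemainder` ∕ `SurvCont` ∕ `Survivors`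
live in `…K2NamedJetsRunRemAt`, which imports the route file).  THIS FILE names them: §1 `RunRowsCont13 F θ` (Sketch26R :40 VERBATIM), `Cont13All` (:49 VERBATIM), `RowsContAll` (the
∀θ programme «prefix → (B) → Window → RunRowsCont13 F θ», the hypothesis of Sketch26R's `k2_7_of_rowsContAll` as a name); §2 the `Iff.rfl` mirrors to the two item texts and to the
inlined rows conjunct; §3 the bridges by name; §4 use forms (constructor, level cut, per-tuple keying).  Successor key of record for every supplier of these rows: `--supports stmt-QuantumFields-26907`.

CONTENTS (3 `def` + 13 theorems; 0 `sorry`; [folklore] bookkeeping; no `instance`, no `notation`, no `axiom`).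

NOT IN THIS FILE (others' lanes, not restated): the K2⁸ closer `…Theorems.BalabanUVNodesK2R8Holds.endpointGivenRunRowsR13SepCoPH_holds` (b2b-an4 op 4, ACCEPTED, item 26908 closed `proved`);
the bridges «corner pair ∕ weak currency at θ ⟹ rows» (b2b-an4 INTENT-4 `…K2RunRowsContOfCorner`); the K1 v7ᴿ third-stub text `RunRowsContAtSomeRecord13PWS` ∕ `k1R8_of_stubs` ∕
`stubCont13_of_cont13All` by name (dag-n24-w1's `…Theorems.BalabanUVNodesK1V7RDefs`, CLAIM-1 pub-ymgap bus l.31880, importing this file's `Cont13All`; K1 v7ᴿ ed.2 REGISTERED on 26907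
2026-08-28T08:18:39Z, skeleton d90044cd05ffffb9: stubs `stub_nodes13PWS` ∕ `stub_runRows13PWS` (v6 VERBATIM) ∕ `stub_cont13 : ∀ F, RunRowsAtSomeRecord13PWS F → RunRowsContAtSomeRecord13PWS F`).

HONEST FRAMING.  Definitions + `Iff.rfl` ∕ binder bookkeeping; NOTHING of Bałaban asserted; no stub proved; nothing registered or re-registered here; no anchor, drift, remainder, floor,
continuity or endpoint is proved to exist anywhere here; K0⁷ stmt-QuantumFields-20541 ∕ K1⁸ stmt-QuantumFields-26907 ∕ K3⁷ stmt-QuantumFields-20544 OPEN (the born-closed SUPPORT K2⁸ 26908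
was closed `proved` 2026-08-28T08:18Z by b2b-an4's `…Theorems.BalabanUVNodesK2R8Holds.endpointGivenRunRowsR13SepCoPH_holds` — an item event, count-neutral, no crux moved); (D1) ∕ (D4) ∕ (C)
NOT discharged; counts unmoved (typed 28∕28 · discharged 5∕27).  [I] Thm 2 + (0.31) p. 259 (NODE O) and [I] §1
pp. 263–264 (continuity of the coefficients) UNPROVED IN PRINT.  Route R4 closes the CONDITIONAL finite-𝕋⁴ rung `BalabanLadder.UV` only — ONE kernel implication on ONE finite 𝕋⁴ at fixed
ε; NOT continuum, NOT ℝ⁴, NOT OS, NOT a mass gap, NOT Clay; the Yang–Mills mass gap is NOT proved by any of this.  Sources (context only): [I] Thm 2 p. 259, Thm 3 p. 264, (1.20)–(1.22) p. 264,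
§1 pp. 263–264, (5.10) p. 293; [II] Lemma 3 (2.38) p. 20, (2.41) p. 21; [V] Thm 1 p. 355.
-/

open scoped Matrix.Norms.L2Operator

namespace Summit.QuantumFields.YangMills.Theorems.BalabanUVNodesK1R8RowsDefs

open Literature.MathematicalPhysics.QuantumFieldTheory.Balaban1983to89
open Literature.MathematicalPhysics.QuantumFieldTheory.Balaban1983to89.FlowStep
open Literature.MathematicalPhysics.QuantumFieldTheory.Balaban1983to89.FlowStepRuns
open Literature.MathematicalPhysics.QuantumFieldTheory.Balaban1983to89.DagBinding
open Literature.MathematicalPhysics.QuantumFieldTheory.Balaban1983to89.T4Continuum (T4Family)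
open Summit.QuantumFields.YangMills.Theorems.BalabanUVNodesK2NamedJetsRunRemAt (RunConstRemainder SurvCont Survivors)
open Summit.QuantumFields.YangMills.Theorems.K1V6Defs (RecordS Inhabited13 NodesAtSomeRecord13PWS Window RunRowsAtSomeRecord13PWS)
open Summit.QuantumFields.YangMills.BalabanUVNodes.K1EndOfNodes13PWSOfRunRemAt (stabilityB_body_of_rung1At_of_runLetters)
open Summit.QuantumFields.YangMills.Theorems.BalabanUVNodesK1WindowKOfRunRowsSurvivors (endpointExistence_datumOfRecord₁₃SepCoPH_of_runRows_survCont)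
open Summit.QuantumFields.YangMills.Theses.BalabanUVNodes
  (StabilityBAtRecordR13SepCoPH EndpointGivenBR13SepCoPH StabilityBRunRowsAtRecordR13SepCoPH EndpointGivenRunRowsR13SepCoPH)

/-! ## §1 The rows of record, by name -/

/-- **RUN ROWS (i)+(iv) + run-wise (C) AT ONE TUPLE, ON SOME LEVEL `γ₀ > 0`** (plan g84 `Sketch26R.RunRowsCont13` VERBATIM = the LAST CONJUNCT of K1⁸ stmt-QuantumFields-26907 and the displayed
hypothesis of K2⁸ stmt-QuantumFields-26908, over the tree carriers): (i) the RUN-WISE CONSTANT REMAINDER `RunConstRemainder β_θ b r γ₀` of `β_θ := Node00.betaOfRecord₁₃ F 2 θ.toStage13Params`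
relative to SOME sequence `b` with radius `r` ([I] Thm 3 p.264 with (1.22); (5.10) p.293; [II] (2.41) p.21), (iv) the RUN-WISE PARTIAL-SUM FLOOR `−M` along every solution of (0.20) staying in
`]0, γ₀]`, (C) RUN-WISE SURVIVOR CONTINUITY `SurvCont β_θ γ₀` ([I] §1 pp.263–264, asserted in print without proof).  `b r γ₀ M` ∃-side; NO drift, NO anchor, NO cap, NO ceiling match.
HYPOTHESIS SHAPE ∕ obligation text, never a fact. [folklore] -/
def RunRowsCont13 (F : T4Family) (θ : Node00.Stage13HParams F 2) : Prop :=
  ∃ (b : ℕ → ℝ) (r γ₀ M : ℝ), 0 < γ₀ ∧ RunConstRemainder (Node00.betaOfRecord₁₃ F 2 θ.toStage13Params) b r γ₀ ∧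
    (∀ (n : ℕ) (gs : ℕ → ℝ), RGEqH n (Node00.betaOfRecord₁₃ F 2 θ.toStage13Params) gs → Step.InInterval γ₀ n gs →
      ∀ k, k ≤ n → -M ≤ ∑ j ∈ Finset.Ico k n, Node00.betaOfRecord₁₃ F 2 θ.toStage13Params j (prefixOf gs j)) ∧
    SurvCont (Node00.betaOfRecord₁₃ F 2 θ.toStage13Params) γ₀

/-- **THE (C) LETTER `Cont13All`** (plan g84 `Sketch26R.Cont13All` VERBATIM — the ONE coupling Variant Rʳ adds to K1 v6's registered texts, director-ym №29 (v)): run-wise survivor continuity of the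
record's β at EVERY admissible Stage-13 tuple with provisos and EVERY level `0 < γ₀ ≤ θ.γ` ([I] §1 pp.263–264: continuity of the coefficients in the couplings, asserted in print without
proof; in-box, `v₀`-free).  A documented SUPPLIER letter of the K1 v7ᴿ third stub (∃→∃ form), WEAKER roads exist (`SurvCont` at the witness only).  HYPOTHESIS SHAPE, never a fact; size M–L;
owner: the (C) desks. [folklore] -/
def Cont13All : Prop :=
  ∀ (F : T4Family) (θ : Node00.Stage13HParams F 2), θ.Provisos₁₃SepCoPH F 2 → θ.Admissible F 2 →
    ∀ γ₀ : ℝ, 0 < γ₀ → γ₀ ≤ θ.γ → SurvCont (Node00.betaOfRecord₁₃ F 2 θ.toStage13Params) γ₀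

/-- **THE ∀θ SUPPLIER PROGRAMME `RowsContAll`** (the hypothesis of plan g84's `Sketch26R.k2_7_of_rowsContAll` ∕ `k1R8_of_k1_7_and_rowsContAll`, as a NAME): at EVERY tuple carrying K2⁷'s prefix
(unity ∧ slots, admissibility, [16] Thm 1 (B) of the datum of record, the non-vacuity window) the rows `RunRowsCont13 F θ`.  Every K2 road of record (v6 named jets, v7-corner pair, U3 letters,
an4's weak currency) is a SUPPLIER of this programme, which gives the aside decl K2⁷ (`endpointGivenBR13SepCoPH_of_rowsContAll`) and, with K1⁷, K1⁸ (`stabilityBRunRowsAtRecordR13SepCoPH_of_k17_rowsContAll`)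
— never conversely (K1⁸ is ∃-side).  `Window` = `K1V6Defs.Window (datum)` (same body as `K2V6Defs.Window13 F θ hP` and as the items' inline window).  HYPOTHESIS SHAPE, never a fact; size XL
(NODE O; instance 0∕1). [folklore] -/
def RowsContAll : Prop :=
  ∀ (F : T4Family) (θ : Node00.Stage13HParams F 2) (hP : θ.Provisos₁₃SepCoPH F 2), (θ.ZhUnity F 2 ∧ θ.SlotsNondegenerate₁₃ F 2) → θ.Admissible F 2 →
    B16.EndStatementBPrinted (Node00.datumOfRecord₁₃SepCoPH F 2 θ hP).C → Window (Node00.datumOfRecord₁₃SepCoPH F 2 θ hP) → RunRowsCont13 F θ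

/-! ## §2 `Iff.rfl` mirrors: the rows by name ≡ the items' inline spelling; the two NEW ITEM TEXTS by name -/

/-- **`RunRowsCont13 F θ` ≡ THE ITEMS' INLINED ROWS CONJUNCT** (route file `Theses/BalabanUVNodes.lean` rev 27 :295 last conjunct ∕ :853 fourth hypothesis, bodies of `RunConstRemainder` ∕
`SurvCont` ∕ `Survivors` inlined there because their home imports the route file), `Iff.rfl`. [folklore] -/
theorem runRowsCont13_iff_inline (F : T4Family) (θ : Node00.Stage13HParams F 2) :
    RunRowsCont13 F θ ↔
      ∃ (b : ℕ → ℝ) (r γ₀ M : ℝ), 0 < γ₀ ∧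
        (∀ (n : ℕ) (gs : ℕ → ℝ), RGEqH n (Node00.betaOfRecord₁₃ F 2 θ.toStage13Params) gs → Step.InInterval γ₀ n gs →
          ∀ k, k ≤ n → |Node00.betaOfRecord₁₃ F 2 θ.toStage13Params k (prefixOf gs k) - b k| ≤ r) ∧
        (∀ (n : ℕ) (gs : ℕ → ℝ), RGEqH n (Node00.betaOfRecord₁₃ F 2 θ.toStage13Params) gs → Step.InInterval γ₀ n gs →
          ∀ k, k ≤ n → -M ≤ ∑ j ∈ Finset.Ico k n, Node00.betaOfRecord₁₃ F 2 θ.toStage13Params j (prefixOf gs j)) ∧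
        ∀ k : ℕ, ContinuousOn (fun x : ℝ => Node00.betaOfRecord₁₃ F 2 θ.toStage13Params k
            (clampPrefix (Node00.betaOfRecord₁₃ F 2 θ.toStage13Params) γ₀ k x))
          {x : ℝ | 0 < x ∧ x ≤ γ₀ ∧ ∀ j, j ≤ k → 1 / γ₀ ^ 2 ≤ FlowStep.Y (Node00.betaOfRecord₁₃ F 2 θ.toStage13Params) γ₀ j x} :=
  Iff.rfl

/-- **K1⁸ BY NAME** (kernel): the route decl `…Theses.BalabanUVNodes.StabilityBRunRowsAtRecordR13SepCoPH` (stmt-QuantumFields-26907, crux r3 DECIDING) is literally «`∀ F, Inhabited13 F → ∃ θ h, (unity ∧ slots) ∧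
Admissible ∧ (B) ∧ Window (datum) ∧ RunRowsCont13 F θ`» — K1⁷'s conclusion AND the rows at the SAME witness (plan g84 `Sketch26R.K1R8` ∕ `k1R8ItemText_iff`), `Iff.rfl`.
[cite: Balaban1989LargeFieldII, Thm 1 p.355; Balaban1987RG1, Thm 3 p.264, (5.10) p.293, §1 pp.263–264 (bookkeeping)] -/
theorem stabilityBRunRowsAtRecordR13SepCoPH_iff :
    StabilityBRunRowsAtRecordR13SepCoPH ↔
      ∀ F : T4Family, Inhabited13 F → ∃ (θ : Node00.Stage13HParams F 2) (h : θ.Provisos₁₃SepCoPH F 2),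
        (θ.ZhUnity F 2 ∧ θ.SlotsNondegenerate₁₃ F 2) ∧ θ.Admissible F 2 ∧ B16.EndStatementBPrinted (Node00.datumOfRecord₁₃SepCoPH F 2 θ h).C ∧
        Window (Node00.datumOfRecord₁₃SepCoPH F 2 θ h) ∧ RunRowsCont13 F θ :=
  Iff.rfl

/-- **K2⁸ BY NAME** (kernel): the route decl `…Theses.BalabanUVNodes.EndpointGivenRunRowsR13SepCoPH` (stmt-QuantumFields-26908, support r9, born closed) is literally «K2⁷'s prefix → `RunRowsCont13 F θ` →
Window (datum) → `EndpointExistence (datum).C.toB12`» (plan g84 `Sketch26R.K2R8` ∕ `k2R8ItemText_iff`), `Iff.rfl`.  This file does NOT prove that decl (its one-line closer is b2b-an4's op 4,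
`…Theorems.BalabanUVNodesK2R8Holds.endpointGivenRunRowsR13SepCoPH_holds`, item closed `proved`); the per-tuple use form is `endpointExistence_of_runRowsCont13` below. [cite: Balaban1987RG1, Thm 2 p.259 (first sentence), Thm 3 p.264, (5.10) p.293, §1 pp.263–264 (bookkeeping)] -/
theorem endpointGivenRunRowsR13SepCoPH_iff :
    EndpointGivenRunRowsR13SepCoPH ↔
      ∀ (F : T4Family) (θ : Node00.Stage13HParams F 2) (h : θ.Provisos₁₃SepCoPH F 2), (θ.ZhUnity F 2 ∧ θ.SlotsNondegenerate₁₃ F 2) → θ.Admissible F 2 →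
        B16.EndStatementBPrinted (Node00.datumOfRecord₁₃SepCoPH F 2 θ h).C → RunRowsCont13 F θ → Window (Node00.datumOfRecord₁₃SepCoPH F 2 θ h) →
        EndpointExistence (Node00.datumOfRecord₁₃SepCoPH F 2 θ h).C.toB12 :=
  Iff.rfl

/-- sanity (kernel): the supplier programme `RowsContAll` is K2⁸'s text with the rows moved from hypothesis to conclusion and END dropped — i.e. the ∀θ END programme of K2⁷ v6∕v7 in the
ROWS currency. `Iff.rfl`. [folklore] -/
theorem rowsContAll_iff :
    RowsContAll ↔
      ∀ (F : T4Family) (θ : Node00.Stage13HParams F 2) (hP : θ.Provisos₁₃SepCoPH F 2), (θ.ZhUnity F 2 ∧ θ.SlotsNondegenerate₁₃ F 2) → θ.Admissible F 2 →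
        B16.EndStatementBPrinted (Node00.datumOfRecord₁₃SepCoPH F 2 θ hP).C →
        (∃ γ₁ : ℝ, 0 < γ₁ ∧ ∀ γ : ℝ, 0 < γ → γ ≤ γ₁ → ∃ P : B12.RunParams, 1 ≤ P.K ∧ ((Node00.datumOfRecord₁₃SepCoPH F 2 θ hP).C P).flow.InInterval γ P.K) →
        RunRowsCont13 F θ :=
  Iff.rfl

/-! ## §3 Bridges by name -/

/-- **K1⁸ IS STRONGER THAN K1⁷** (drop the rows): the aside decl `…StabilityBAtRecordR13SepCoPH` (stmt-QuantumFields-20542) from K1⁸ (plan g84 `Sketch26R.k1_7_of_k1R8`).  CONDITIONAL; nothing closed.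
[cite: Balaban1989LargeFieldII, Thm 1 p.355 (bookkeeping)] -/
theorem stabilityBAtRecordR13SepCoPH_of_runRows (h : StabilityBRunRowsAtRecordR13SepCoPH) : StabilityBAtRecordR13SepCoPH := by
  intro F hF
  obtain ⟨θ, hP, hU, hθ, hb, hwin, -⟩ := h F hF
  exact ⟨θ, hP, hU, hθ, hb, hwin⟩

/-- **PER-TUPLE USE FORM OF THE END THEOREM OF RECORD**: the rows `RunRowsCont13 F θ` ⟹ endpoint existence of the datum of record at `(θ, h)` — one `obtain`, then dag-n13-w4's
`…K1WindowKOfRunRowsSurvivors.endpointExistence_datumOfRecord₁₃SepCoPH_of_runRows_survCont` BY NAME (unbounded Tietze + the tree's run-wise shooting; unity, admissibility, (B), window UNUSED).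
CONDITIONAL on the rows; NOT the K2⁸ item decl (whose closer is b2b-an4's `…K2R8Holds.endpointGivenRunRowsR13SepCoPH_holds`). [cite: Balaban1987RG1, Thm 2 p.259 (first sentence), Thm 3 p.264, (5.10) p.293, §1 pp.263–264] -/
theorem endpointExistence_of_runRowsCont13 {F : T4Family} (θ : Node00.Stage13HParams F 2) (h : θ.Provisos₁₃SepCoPH F 2) (hrows : RunRowsCont13 F θ) :
    EndpointExistence (Node00.datumOfRecord₁₃SepCoPH F 2 θ h).C.toB12 := by
  obtain ⟨b, r, γ₀, M, hγ₀, hrem, hps, hsc⟩ := hrows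
  exact endpointExistence_datumOfRecord₁₃SepCoPH_of_runRows_survCont θ h hγ₀ hrem hps hsc

/-- **THE SUPPLIER PROGRAMME ⟹ THE ASIDE DECL K2⁷** `…Theses.BalabanUVNodes.EndpointGivenBR13SepCoPH` (stmt-QuantumFields-20543) BY NAME (plan g84 `Sketch26R.k2_7_of_rowsContAll`): so every K2 road that
concludes `RowsContAll` still concludes K2⁷ as filed.  CONDITIONAL; K2⁷ NOT closed. [cite: Balaban1987RG1, Thm 2 p.259 (first sentence), Thm 3 p.264, (5.10) p.293] -/
theorem endpointGivenBR13SepCoPH_of_rowsContAll (h : RowsContAll) : EndpointGivenBR13SepCoPH := by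
  intro F θ hP hU hθ hB hwin
  exact endpointExistence_of_runRowsCont13 θ hP (h F θ hP hU hθ hB hwin)

/-- **K1⁷ + THE SUPPLIER PROGRAMME ⟹ K1⁸ BY NAME** (plan g84 `Sketch26R.k1R8_of_k1_7_and_rowsContAll`): the rows are read at K1⁷'s own witness.  CONDITIONAL on both displayed texts; K1⁸ NOT closed.
[cite: Balaban1989LargeFieldII, Thm 1 p.355; Balaban1987RG1, Thm 3 p.264, (5.10) p.293, §1 pp.263–264 (bookkeeping)] -/
theorem stabilityBRunRowsAtRecordR13SepCoPH_of_k17_rowsContAll (h1 : StabilityBAtRecordR13SepCoPH) (h : RowsContAll) :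
    StabilityBRunRowsAtRecordR13SepCoPH := by
  intro F hF
  obtain ⟨θ, hP, hU, hθ, hb, hwin⟩ := h1 F hF
  exact ⟨θ, hP, hU, hθ, hb, hwin, h F θ hP hU hθ hb hwin⟩

/-! ## §4 Use forms: constructor, level cut, (C) read from `Cont13All`, per-tuple keying of the programme -/

/-- CONSTRUCTOR: rows (i), (iv) and (C) at a COMMON level `γ₀ > 0` ⟹ `RunRowsCont13 F θ`. [folklore] -/
theorem runRowsCont13_intro {F : T4Family} (θ : Node00.Stage13HParams F 2) {b : ℕ → ℝ} {r γ₀ M : ℝ} (hγ₀ : 0 < γ₀)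
    (hrem : RunConstRemainder (Node00.betaOfRecord₁₃ F 2 θ.toStage13Params) b r γ₀)
    (hps : ∀ (n : ℕ) (gs : ℕ → ℝ), RGEqH n (Node00.betaOfRecord₁₃ F 2 θ.toStage13Params) gs → Step.InInterval γ₀ n gs →
      ∀ k, k ≤ n → -M ≤ ∑ j ∈ Finset.Ico k n, Node00.betaOfRecord₁₃ F 2 θ.toStage13Params j (prefixOf gs j))
    (hsc : SurvCont (Node00.betaOfRecord₁₃ F 2 θ.toStage13Params) γ₀) : RunRowsCont13 F θ :=
  ⟨b, r, γ₀, M, hγ₀, hrem, hps, hsc⟩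

/-- **LEVEL CUT**: rows (i)+(iv) on level `γ₀` and (C) on a SMALLER level `0 < γ₁ ≤ γ₀` ⟹ `RunRowsCont13 F θ` (on level `γ₁`: in-window runs of level `γ₁` are in-window runs of level `γ₀` —
`RunConstRemainder.mono`, the floor antitone in the level).  This is how (C) from a box letter (`…Gaps.EndSurvivorCensus.survCont_of_betaContH`, level `min γ₀ θ.γ`) or from `Cont13All` meets rows
obtained on the remainder chain's own level. [folklore] -/
theorem runRowsCont13_of_rows_survCont_le {F : T4Family} (θ : Node00.Stage13HParams F 2) {b : ℕ → ℝ} {r γ₀ γ₁ M : ℝ} (hγ₁ : 0 < γ₁) (hle : γ₁ ≤ γ₀)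
    (hrem : RunConstRemainder (Node00.betaOfRecord₁₃ F 2 θ.toStage13Params) b r γ₀)
    (hps : ∀ (n : ℕ) (gs : ℕ → ℝ), RGEqH n (Node00.betaOfRecord₁₃ F 2 θ.toStage13Params) gs → Step.InInterval γ₀ n gs →
      ∀ k, k ≤ n → -M ≤ ∑ j ∈ Finset.Ico k n, Node00.betaOfRecord₁₃ F 2 θ.toStage13Params j (prefixOf gs j))
    (hsc : SurvCont (Node00.betaOfRecord₁₃ F 2 θ.toStage13Params) γ₁) : RunRowsCont13 F θ :=
  ⟨b, r, γ₁, M, hγ₁, hrem.mono hle,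
    fun n gs hrg hI k hk => hps n gs hrg (fun j hj => ⟨(hI j hj).1, (hI j hj).2.trans hle⟩) k hk, hsc⟩

/-- **(C) READ FROM `Cont13All` AT THE TUPLE ITSELF**: rows (i)+(iv) on level `γ₀` at an admissible tuple with provisos and `0 < θ.γ`, plus the letter ⟹ `RunRowsCont13 F θ` on level `min γ₀ θ.γ`.
CONDITIONAL on the letter. [folklore] -/
theorem runRowsCont13_of_rows_cont13All {F : T4Family} (θ : Node00.Stage13HParams F 2) (hP : θ.Provisos₁₃SepCoPH F 2) (hθ : θ.Admissible F 2) (hγ : 0 < θ.γ)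
    (hC : Cont13All) {b : ℕ → ℝ} {r γ₀ M : ℝ} (hγ₀ : 0 < γ₀)
    (hrem : RunConstRemainder (Node00.betaOfRecord₁₃ F 2 θ.toStage13Params) b r γ₀)
    (hps : ∀ (n : ℕ) (gs : ℕ → ℝ), RGEqH n (Node00.betaOfRecord₁₃ F 2 θ.toStage13Params) gs → Step.InInterval γ₀ n gs →
      ∀ k, k ≤ n → -M ≤ ∑ j ∈ Finset.Ico k n, Node00.betaOfRecord₁₃ F 2 θ.toStage13Params j (prefixOf gs j)) : RunRowsCont13 F θ :=
  runRowsCont13_of_rows_survCont_le θ (lt_min hγ₀ hγ) (min_le_left _ _) hrem hps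
    (hC F θ hP hθ (min γ₀ θ.γ) (lt_min hγ₀ hγ) (min_le_right _ _))

/-- **PER-TUPLE KEYING**: the rows at every admissible Stage-13 tuple with provisos ⟹ the supplier programme (unity, (B), window unused). [folklore] -/
theorem rowsContAll_of_adm
    (h : ∀ (F : T4Family) (θ : Node00.Stage13HParams F 2), θ.Provisos₁₃SepCoPH F 2 → θ.Admissible F 2 → RunRowsCont13 F θ) : RowsContAll :=
  fun F θ hP _ hθ _ _ => h F θ hP hθ

/-- **№29 (i)+(v) CERTIFICATE IN THE TREE: K1⁸ BY NAME FROM K1 v6's TWO REGISTERED STUB TEXTS VERBATIM + THE (C) LETTER** (plan g84 `Sketch26R.k1R8_of_stubTexts_cont`, proof carried over):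
`h₁` = `stub_nodes13PWS`'s text, `h₂` = `stub_runRows13PWS`'s text (`K1V6Defs` names, `Iff.rfl` to the registered K1 v6 skeleton 03f66ac9cc89391f, byte-identical in K1 v7ᴿ); the rows (i)+(iv) ARE
stub 2″'s rows at its own witness; K1⁷'s body at that witness is p598782 §2's `stabilityB_body_of_rung1At_of_runLetters` (= K1 v6's composition); (C) is read from `Cont13All` at the `RecordS`
partner `θ'` (same datum, `0 < w.γ ≤ θ'.γ`) on level `min γ₀ w.γ`, the rows cut to that level (`runRowsCont13_of_rows_survCont_le`).  CONDITIONAL on the three displayed texts; K1⁸ NOT closed;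
the K1 v7ᴿ skeleton's own third stub is the WEAKER ∃→∃ text (K1 lane). [cite: Balaban1989LargeFieldII, Thm 1 p.355 + (0.1) pp.355–356; Balaban1987RG1, Thm 3 p.264, (5.10) p.293, §1 pp.263–264 (bookkeeping)] -/
theorem stabilityBRunRowsAtRecordR13SepCoPH_of_stubTexts_cont
    (h₁ : ∀ F : T4Family, Inhabited13 F → NodesAtSomeRecord13PWS F)
    (h₂ : ∀ F : T4Family, NodesAtSomeRecord13PWS F → RunRowsAtSomeRecord13PWS F)
    (hC : Cont13All) : StabilityBRunRowsAtRecordR13SepCoPH := by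
  intro F hinh
  obtain ⟨θ, h, w, hU, hθ, hR, hnodes, b, r, γ₀, B, M, hγ₀, hrem, hB, hmatch, hps⟩ := h₂ F (h₁ F hinh)
  refine ⟨θ, h, ?_⟩
  obtain ⟨hU', hθ', hb, hwin⟩ := stabilityB_body_of_rung1At_of_runLetters θ h w hU hθ hR hnodes hγ₀ hrem hB hmatch hps
  refine ⟨hU', hθ', hb, hwin, ?_⟩
  obtain ⟨θ', h', hθ'adm, hD, _hC, ⟨hwγ, hwγle⟩, _hL, _hup⟩ := hR
  have hβ : Node00.betaOfRecord₁₃ F 2 θ'.toStage13Params = Node00.betaOfRecord₁₃ F 2 θ.toStage13Params := by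
    have := congrArg (fun D => D.βfun) hD
    simpa [Node00.βfun_datumOfRecord₁₃SepCoPH] using this.symm
  have hsc : SurvCont (Node00.betaOfRecord₁₃ F 2 θ.toStage13Params) (min γ₀ w.γ) := by
    have := hC F θ' h' hθ'adm (min γ₀ w.γ) (lt_min hγ₀ hwγ) ((min_le_right _ _).trans hwγle)
    rwa [hβ] at this
  exact runRowsCont13_of_rows_survCont_le θ (lt_min hγ₀ hwγ) (min_le_left _ _) hrem hps hsc

end Summit.QuantumFields.YangMills.Theorems.BalabanUVNodesK1R8RowsDefs
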